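import Summits.CriticalPhenomena.PercolationContinuityZ3.Theorems.PercNearOneGluingNoHeavyQuantHullHighCons
import Summits.CriticalPhenomena.PercolationContinuityZ3.Theorems.PercNearOneGluingNoHeavyQuantForestBridge
import HarnessLib

/-!
# QUANT lane R8, T-DEC: **THE NODE `SiblingStep` REDUCED TO ITS FAR-GIANT RESIDUE** — it owes only forests in which EVERY sibling is neither tame
# nor hull+high decomposable (arm-1 gen 57, architect)

builds on p205010 (kernel theorem, internal audit signed; external expert review pending)

Support file (`--supports stmt-CriticalPhenomena-4575`), QUANT lane seat prim-quant-arm-1 (gen 57, architect); memo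
`run/shared/lean/prim/quant/prim-quant-arm-1-g57/ARCH-G57.md` §6.  One theorem; standard axioms, no sorries, no definitions.

WHAT.  The node of record `LawDec.SiblingStep` (✓ `…QuantSiblingStep`; list binder `siblingStep_iff_list`, ✓ `…QuantForestBridge`: a tree-OK sibling list `L`
with `≥ 3` siblings at `0 < x < 1` and the oracle "every tree-built law on fewer than `fgates L` gates is SDEC" ⟹ `SDEC x (ftop L) (flaw L)`) follows from its
restriction to the FAR-GIANT RESIDUE: lists in which NO sibling is TAME at `x` (every charged count light or floored; arm-1 g56/g57 `sdec_siblings_of_tame'`,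
✓ `…QuantHullHighCons`, resting on COMP-SLICE ✓ `…QuantCompSlice`) and NO sibling has a HULL+HIGH decomposable gated law (prim-quant-census-1 g29's `HullHigh`;
`sdec_siblings_of_hullHigh`, ✓ `…QuantHullHighCons`, resting on HIGH-CONV ✓ `…QuantHighConv`).  Canonical residue members (census-1 g29 §0 (6), ARCH-G56 §2):
the near-sure glued child `R[q](R²[g])`, `R²[½](R⁹[.99])`, a near-sure leaf under a lighter relay — a charged count that is heavy and unfloored in a law that is
not a mixture of (high law) ∗ (heavy blobs).

* **`siblingStep_of_farGiantResidue`** — (the node on the residue) ⟹ `SiblingStep`.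

HONEST STATUS.  `SiblingStep` / `GateStepN` / `LightResidDECOracle` / `FarTreeRow` OPEN (the residue is); RATE class (log\*) / honest sentence of
`run/shared/lean/prim/quant/README.md` unchanged.  [this work].  Nothing here is cited as a published result.  The gluing rows served
[cite: KozmaNitzan2024, Conjecture 3 (p. 15)]; product measure [cite: Grimmett1999, §1.3 p. 10].
-/

noncomputable section

namespace Summit.CriticalPhenomena.PercolationContinuityZ3.Theorems
namespace Quant
namespace LawDec

/-- **`SiblingStep` FROM ITS FAR-GIANT RESIDUE.**  If the node's conclusion holds for every tree-OK list of `≥ 3` siblings at `0 < x < 1` NONE of which is tame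
at `x` and NONE of which has a hull+high decomposable gated law (given the oracle below the gate budget), then `SiblingStep` holds — every other list has a
tame or a hull+high sibling, which is free on the binder (`sdec_siblings_of_tame'`, `sdec_siblings_of_hullHigh`). [this work] -/
theorem siblingStep_of_farGiantResidue
    (hres : ∀ (x : ℝ) (L : List Sib), 0 < x → x < 1 → (∀ s ∈ L, s.TreeOK x) → 3 ≤ L.length →
      (∀ s ∈ L, ¬ (∀ h : ℕ, 1 ≤ h → s.ρ h ≠ 0 → s.q * s.mean ≤ 2 * h ∨ x * ((s.M : ℝ) - h) ≤ s.q * s.mean - h)) →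
      (∀ s ∈ L, ¬ HullHigh x (s.q * s.mean) s.M (gate s.ρ s.q)) →
      (∀ (x' : ℝ) (n' M' : ℕ) (μ' : ℕ → ℝ), n' < fgates L → TreeBuiltN x' n' M' μ' → SDEC x' M' μ') →
      SDEC x (ftop L) (flaw L)) :
    SiblingStep := by
  rw [siblingStep_iff_list]
  intro x L hx0 hx1 hL hk hO
  by_cases h1 : ∃ s ∈ L, ∀ h : ℕ, 1 ≤ h → s.ρ h ≠ 0 → s.q * s.mean ≤ 2 * h ∨ x * ((s.M : ℝ) - h) ≤ s.q * s.mean - h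
  · exact sdec_siblings_of_tame' hx0 L hL hO h1
  by_cases h2 : ∃ s ∈ L, HullHigh x (s.q * s.mean) s.M (gate s.ρ s.q)
  · exact sdec_siblings_of_hullHigh hx0 L hL hO h2
  exact hres x L hx0 hx1 hL hk (fun s hs ht => h1 ⟨s, hs, ht⟩) (fun s hs hh => h2 ⟨s, hs, hh⟩) hO

end LawDec
end Quant
end Summit.CriticalPhenomena.PercolationContinuityZ3.Theorems
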